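import Mathlib
import Summits.Ventures.HodgeRepro.Tier4.Line1.RTFSetting
import Summits.Ventures.HodgeRepro.Tier4.Line1.HeckeFinitenessType
import Summits.Ventures.HodgeRepro.Tier4.Line1.LevelBlockFinite
import Summits.Ventures.HodgeRepro.Tier4.Line1.HeckeBlockIdempotent
import Summits.Ventures.HodgeRepro.Tier4.Line1.IsotypicIdempotent
import Summits.Ventures.HodgeRepro.Tier4.Line1.IsotypicSchur
import Summits.Ventures.HodgeRepro.Tier4.Line1.IsotypicBlock

/-!
# Tier4/Line1/IsotypicInstance — `R(eσ)` FIXES every function of left type σ, and the TYPE-σ INSTANCE of p5's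
`IdempotentData` (module 4 of plan-1's cut (S3σ) S14082; consumer p5's `HeckeBlockIdempotent` p689660)

Blind re-derivation cell `pub-hodge-repro`, Tier 4 (README §9–§10), seat t4-L1-p3 (prover, LINE L1, gen 3).  Target tree
path `lean/Summits/Ventures/HodgeRepro/Tier4/Line1/IsotypicInstance.lean`.  Imports this seat's `IsotypicIdempotent`
(p690327), `IsotypicSchur` (p690696: `schur_orthogonality`, `measure_toReal_ne_zero`), `IsotypicBlock` (`coeff`,
`isotypicFixed`, `finiteDimensional_isotypicFixed`), p5's `HeckeBlockIdempotent` (p689660: `IdempotentData`), p1's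
`HeckeFinitenessType` / `LevelBlockFinite`.  0 printed inputs.

CONTENT.  **`R_eσ_of_hasLeftType`**: `R(eσ) ψ = ψ` for EVERY `ψ` of left type `coeff ρ` (write `ψ(x k) = ∑_p a_p ρ(k)_{i_p j_p}`
on `K`, integrate against `eσ = d μ(K)⁻¹ conj χ_σ` and apply `schur_orthogonality` with `conj χ_σ(h) = ∑_l ρ(h⁻¹)_{ll}`:
`∫_K ρ(h)_{ij} ρ(h⁻¹)_{ll} dμ = (μ(K)/d)[i = l][l = j]`, so the integral is `∑_p a_p [i_p = j_p] = ψ(x · 1)`); hence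
`mem_isotypicFixed_iff_levelBlock`: the type-σ block IS p1's `levelBlock S K (coeff ρ) ∩ {continuous}`.
**`IdempotentData.ofIsotypic`**: the `IdempotentData` on `isotypicFixed` with `e := eσ` and the fields `he`, `he_conv`,
`he_sym`, `hVb` and `[FiniteDimensional ℂ Vb]` DISCHARGED; what stays DISPLAYED (exactly as in p5's spherical instance):
the Hecke elements with `tst r ⋆ eσ = tst r`, the convolution law `hact`, the constituents `W`, the projections `π`,
(C1), (C2).  `exists_isolatedAt_isotypic` = (S3a) on the type-σ block from exactly those.  Nothing of (C1), (C2), the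
Hecke data or the instance's corner forms is proved; nothing here moves (P).  Nothing here says anything about the status
of the Hodge conjecture for CM abelian varieties, which is NOT proved (HC_CM is NOT proved by anyone in this repository).
-/

set_option autoImplicit false

noncomputable section

namespace Summit.Ventures.HodgeRepro.Tier4.Line1

open MeasureTheory Topology Set Matrix

namespace RTF.Setting

variable {G : Type} [Group G] [TopologicalSpace G] [IsTopologicalGroup G] [MeasurableSpace G] [BorelSpace G]
  (S : Setting G) (K : Subgroup G) {d : ℕ} (ρ : K →* Matrix (Fin d) (Fin d) ℂ)

section Fixed

variable (hKo : IsOpen (K : Set G)) (hKc : IsCompact (K : Set G)) (hρ : Continuous ρ)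

include hKo hKc hρ in
/-- `∫_K conj χ_σ(h) ρ̃(h)_{ij} dμ(h) = (μ(K)/d) [i = j]` (Schur orthogonality with `conj χ_σ(h) = ∑_l ρ̃(h⁻¹)_{ll}`). -/
theorem setIntegral_conj_charExt_mul_coef (hu : IsUnitaryRep ρ) (hirr : IsIrreducibleRep ρ) (i j : Fin d) :
    ∫ h in (K : Set G), starRingEnd ℂ (charExt K ρ h) * repExt K ρ h i j ∂S.μ
      = ((((S.μ (K : Set G)).toReal / d : ℝ)) : ℂ) * (if i = j then 1 else 0) := by
  haveI := S.haar
  have hm : MeasurableSet (K : Set G) := hKo.measurableSet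
  have hexp : ∀ h ∈ (K : Set G), starRingEnd ℂ (charExt K ρ h) * repExt K ρ h i j
      = ∑ l, repExt K ρ h i j * repExt K ρ h⁻¹ l l := by
    intro h _
    rw [← charExt_inv K ρ hu h]
    unfold charExt
    simp only [Matrix.trace, Matrix.diag, Finset.sum_mul]
    refine Finset.sum_congr rfl fun l _ => mul_comm _ _
  rw [setIntegral_congr_fun hm hexp,
    integral_finsetSum _ fun l _ => integrableOn_coef_mul S K ρ hKo hKc hρ i j l l]
  simp only [schur_orthogonality S K ρ hKo hKc hρ hirr]
  simp [Finset.sum_ite_eq']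

include hKo hKc hρ in
/-- **`R(eσ)` FIXES EVERY FUNCTION OF LEFT TYPE σ**: for `ψ` with `HasLeftType K (coeff ρ) ψ`, `R(eσ) ψ = ψ`. -/
theorem R_eσ_of_hasLeftType (hu : IsUnitaryRep ρ) (hirr : IsIrreducibleRep ρ) {ψ : G → ℂ}
    (hL : HasLeftType K (coeff ρ) ψ) : S.R (eσ S K ρ) ψ = ψ := by
  haveI := S.haar
  have hm : MeasurableSet (K : Set G) := hKo.measurableSet
  funext x
  obtain ⟨a, ha⟩ := (Submodule.mem_span_range_iff_exists_fun ℂ).mp (hL x)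
  have hψ : ∀ h ∈ (K : Set G), ψ (x * h)
      = ∑ p, a p * repExt K ρ h (finProdFinEquiv.symm p).1 (finProdFinEquiv.symm p).2 := by
    intro h hh
    have := congrFun ha ⟨h, hh⟩
    simp only [Finset.sum_apply, Pi.smul_apply, smul_eq_mul, coeff] at this
    rw [← this, repExt_of_mem K ρ hh]
  set c : ℂ := (d : ℂ) * ((((S.μ (K : Set G)).toReal)⁻¹ : ℝ) : ℂ) with hc
  -- the integral lives on `K`
  have h1 : S.R (eσ S K ρ) ψ x = ∫ h in (K : Set G), eσ S K ρ h * ψ (x * h) ∂S.μ := by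
    unfold R
    rw [setIntegral_eq_integral_of_forall_compl_eq_zero]
    intro h hh
    rw [eσ_of_not_mem S K ρ hh, zero_mul]
  have h2 : ∫ h in (K : Set G), eσ S K ρ h * ψ (x * h) ∂S.μ
      = ∫ h in (K : Set G), ∑ p, (c * a p) * (starRingEnd ℂ (charExt K ρ h)
          * repExt K ρ h (finProdFinEquiv.symm p).1 (finProdFinEquiv.symm p).2) ∂S.μ := by
    refine setIntegral_congr_fun hm fun h hh => ?_
    rw [hψ h hh]
    unfold eσ
    rw [← hc, Finset.mul_sum]
    refine Finset.sum_congr rfl fun p _ => ?_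
    ring
  have hint : ∀ p : Fin (d * d), Integrable (fun h => (c * a p) * (starRingEnd ℂ (charExt K ρ h)
      * repExt K ρ h (finProdFinEquiv.symm p).1 (finProdFinEquiv.symm p).2)) (S.μ.restrict (K : Set G)) := by
    intro p
    refine Integrable.const_mul ?_ _
    have hcont : Continuous fun h => starRingEnd ℂ (charExt K ρ h)
        * repExt K ρ h (finProdFinEquiv.symm p).1 (finProdFinEquiv.symm p).2 :=
      (continuous_star.comp (continuous_charExt K ρ hKo hρ)).mul
        ((continuous_repExt K ρ hKo hρ).matrix_elem _ _)
    have hsupp : HasCompactSupport fun h => starRingEnd ℂ (charExt K ρ h)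
        * repExt K ρ h (finProdFinEquiv.symm p).1 (finProdFinEquiv.symm p).2 :=
      HasCompactSupport.intro' hKc (K.isClosed_of_isOpen hKo) fun g hg => by
        simp [repExt_of_not_mem K ρ hg]
    exact (hcont.integrable_of_hasCompactSupport hsupp).integrableOn
  rw [h1, h2, integral_finsetSum _ fun p _ => hint p]
  simp only [integral_const_mul, setIntegral_conj_charExt_mul_coef S K ρ hKo hKc hρ hu hirr]
  -- `ψ x = ψ (x * 1) = ∑ p, a p * [i_p = j_p]`
  have hx : ψ x = ∑ p, a p * (if (finProdFinEquiv.symm p).1 = (finProdFinEquiv.symm p).2 then (1 : ℂ) else 0) := by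
    have := hψ 1 K.one_mem
    rw [mul_one, repExt_one] at this
    rw [this]
    refine Finset.sum_congr rfl fun p _ => ?_
    rw [Matrix.one_apply]
  rw [hx]
  refine Finset.sum_congr rfl fun p _ => ?_
  have hμ : ((S.μ (K : Set G)).toReal : ℂ) ≠ 0 := by exact_mod_cast measure_toReal_ne_zero S K hKo hKc
  have hd : (d : ℂ) ≠ 0 := by exact_mod_cast (Fin.pos (finProdFinEquiv.symm p).1).ne'
  rw [hc, Complex.ofReal_div, Complex.ofReal_natCast, Complex.ofReal_inv]
  field_simp

include hKo hKc hρ in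
/-- **THE TYPE-σ BLOCK IS p1's LEVEL BLOCK** (on continuous functions): `ψ ∈ isotypicFixed ↔ ψ ∈ levelBlock S K (coeff ρ)
∧ Continuous ψ`. -/
theorem mem_isotypicFixed_iff_levelBlock (hu : IsUnitaryRep ρ) (hirr : IsIrreducibleRep ρ) (ψ : G → ℂ) :
    ψ ∈ isotypicFixed S K ρ hKo hKc hρ ↔ ψ ∈ levelBlock S K (coeff ρ) ∧ Continuous ψ := by
  constructor
  · intro hψ
    exact ⟨isotypicFixed_le_levelBlock S K ρ hKo hKc hρ hu hψ, hψ.2.1⟩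
  · rintro ⟨hψ, hc⟩
    exact ⟨hψ.1, hc, R_eσ_of_hasLeftType S K ρ hKo hKc hρ hu hirr hψ.2⟩

end Fixed

section Instance

variable (hKo : IsOpen (K : Set G)) (hKc : IsCompact (K : Set G)) (hρ : Continuous ρ)
  (hu : IsUnitaryRep ρ) (hirr : IsIrreducibleRep ρ)
  (τ : ℕ → Set (G → ℂ)) (m : ℕ) (H : Type) [Ring H] [Algebra ℂ H] (ι : Type) [Fintype ι] [DecidableEq ι]
  [Module H (isotypicFixed S K ρ hKo hKc hρ)] [IsScalarTower ℂ H (isotypicFixed S K ρ hKo hKc hρ)]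

/-- **THE TYPE-σ INSTANCE OF p5's `IdempotentData`**: `e := eσ`, block := `isotypicFixed`; `he`, `he_conv`, `he_sym`,
`hVb` and the finite-dimensionality DISCHARGED; the Hecke elements (`tst`, `htst`, `htst_conv : tst r ⋆ eσ = tst r`),
the convolution law `hact`, the constituents `W` / projections `π`, (C1) and (C2) stay DISPLAYED as arguments. -/
def IdempotentData.ofIsotypic
    (tst : H → (G → ℂ)) (htst : ∀ r, IsTest (tst r)) (htst_conv : ∀ r, S.conv (tst r) (eσ S K ρ) = tst r)
    (hact : ∀ (r : H) (ψ : isotypicFixed S K ρ hKo hKc hρ),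
      ((r • ψ : isotypicFixed S K ρ hKo hKc hρ) : G → ℂ) = S.R (tst r) ψ)
    (idx : ι → ℕ) (i₀ : ι) (hi₀ : idx i₀ = m) (W : ι → Submodule H (isotypicFixed S K ρ hKo hKc hρ))
    (hW : ∀ (i : ι) (ψ : isotypicFixed S K ρ hKo hKc hρ), ψ ∈ W i ↔ (ψ : G → ℂ) ∈ τ (idx i))
    (π : ι → isotypicFixed S K ρ hKo hKc hρ →ₗ[H] isotypicFixed S K ρ hKo hKc hρ)
    (hπmem : ∀ i v, π i v ∈ W i) (hπsum : ∀ v, ∑ i, π i v = v) (hπid : ∀ i, ∀ w ∈ W i, π i w = w)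
    (hπzero : ∀ i j, i ≠ j → ∀ w ∈ W j, π i w = 0) [simple : ∀ i, IsSimpleModule H (W i)]
    (hnon : ∀ i j, i ≠ j → IsEmpty ((W i) ≃ₗ[H] (W j))) :
    haveI := finiteDimensional_isotypicFixed S K ρ hKo hKc hρ hu
    IdempotentData S τ m H ι (isotypicFixed S K ρ hKo hKc hρ) :=
  haveI := finiteDimensional_isotypicFixed S K ρ hKo hKc hρ hu
  { e := eσ S K ρ
    he := isTest_eσ S K ρ hKo hKc hρ
    he_conv := conv_eσ_eσ S K ρ hKo hKc hρ hirr
    he_sym := cj_refl_eσ S K ρ hu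
    hVb := mem_isotypicFixed S K ρ hKo hKc hρ
    tst := tst
    htst := htst
    htst_conv := htst_conv
    hact := hact
    idx := idx
    i₀ := i₀
    hi₀ := hi₀
    W := W
    hW := hW
    π := π
    hπmem := hπmem
    hπsum := hπsum
    hπid := hπid
    hπzero := hπzero
    simple := simple
    hnon := hnon }

end Instance

section Nonzero

omit [IsTopologicalGroup G] [BorelSpace G] in
/-- at the identity: `eσ 1 = (d · μ(K)⁻¹) · d` (`χ_σ(1) = trace 1 = d`). -/
theorem eσ_one : eσ S K ρ 1 = ((d : ℂ) * ((((S.μ (K : Set G)).toReal)⁻¹ : ℝ) : ℂ)) * d := by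
  unfold eσ charExt
  rw [repExt_one, Matrix.trace_one, Fintype.card_fin, map_natCast]

omit [IsTopologicalGroup G] [BorelSpace G] in
/-- **`eσ ≠ 0` for `1 ≤ d`** on a compact open `K` (crit-1's record S14176 (b): `d = 0` is the only degenerate case; then
`eσ = 0` and the block is `0`). -/
theorem eσ_ne_zero (hKo : IsOpen (K : Set G)) (hKc : IsCompact (K : Set G)) (hd : 0 < d) : eσ S K ρ ≠ 0 := by
  intro h0
  have h1 := congrFun h0 1
  rw [eσ_one, Pi.zero_apply] at h1
  have hμ : ((((S.μ (K : Set G)).toReal)⁻¹ : ℝ) : ℂ) ≠ 0 := by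
    rw [Complex.ofReal_inv]
    exact inv_ne_zero (by exact_mod_cast measure_toReal_ne_zero S K hKo hKc)
  have hd' : (d : ℂ) ≠ 0 := by exact_mod_cast hd.ne'
  exact (mul_ne_zero (mul_ne_zero hd' hμ) hd') h1

end Nonzero

end RTF.Setting

end Summit.Ventures.HodgeRepro.Tier4.Line1
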